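import Summits.ResolutionOfSingularities.ResolutionOfSingularities.Theorems.MarkedTransferCampaignW46MohWindowProof
import HarnessLib

/-!
# [OURS · L1 W4.6, rung (iii)] The Moh window on curves — the ∇-centred reading and the finiteness slice (lane-A notes on
# OURS-DESK #36) (cell res-hironaka, LADDER-RESOLUTION rung L, D-0089; slot W4.6, seat res-L1-s46-pv-5; host route
# MarkedTransfer, `--supports stmt-ResolutionOfSingularities-16155 --as helper`)

HONEST FRAMING. Nothing here is a statement of H. Hironaka's manuscript (2017-03-23, [Hironaka2017]) and nothing here
asserts that any statement of it holds. Pure-logic / bookkeeping corollaries of `Theorems/MarkedTransferCampaignW46MohWindowProof.lean`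
(same seat) answering the two lane-A reading notes of res-L1-ref-a1 on OURS-DESK #36 (STATUS 2026-08-27T00:04:53Z):

* (ii) «`MohWindowCurveTerminates` is stated over the literal-rule `Terminates`, whose general role was WITHDRAWN (typed-procedure
  module v3, D1) for the ∇-centred `TerminatesNabla`». The literal form is the STRONGER statement; here is the ∇-centred
  consequence by name: `terminatesNabla_mohWindowCurve` — for every notion instance `N` and reading `Rd` there is no infinite
  ∇-CENTRED run of the typed procedure in `Regime.mohWindowCurve` (anchor `terminatesNabla_of_terminates`), with the exit bound
  `RunNabla.exists_exit_le_ncard_of_mohWindowCurve` (`#Sing(E₀)` steps).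
* (i) «`MohWindowCurveStepDrop` concludes `#Sing(E′) < #Sing(E)` without asserting `Sing(E′)` finite (`Set.ncard` is `0` on
  infinite sets)». Here is the missing conjunct as a theorem: `Step.sing_finite_of_mohWindowCurve` — in the regime `Sing(E′)` is
  finite (it injects into `Sing(E) ∖ {ξ}`), so the strict drop is a drop of genuine cardinalities; packaged with the drop as
  `Step.sing_finite_and_ncard_lt_of_mohWindowCurve`.

No FACT-LIST premise; no `sorry`; axioms standard. AI review is weaker than expert review.

## References

* `Theorems/MarkedTransferCampaignW46MohWindow.lean` / `…MohWindowProof.lean` (this seat, p472581 / p473117);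
  `…TypedProcedure.lean` v3 §«∇-centred runs», `…TypedProcedureAnchors.lean` (`terminatesNabla_of_terminates`).
* H. Hironaka, ms. 2017-03-23, §16.2 p.84 l.2, Th. 16.6 (4) p.84 l.29, Th. 16.13 p.87 l.26–28 — scope only, under
  adjudication, not cited as fact. [Hironaka2017]
-/

noncomputable section

set_option linter.dupNamespace false -- mandated namespace of this single-conjunct summit

open CategoryTheory AlgebraicGeometry TopologicalSpace IsLocalRing

namespace Summit.ResolutionOfSingularities.ResolutionOfSingularities.Theorems

namespace CampaignW46

open Literature.AlgebraicGeometry.Resolution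
open Literature.AlgebraicGeometry.Hironaka2017.S02Preliminaries
open Literature.AlgebraicGeometry.Hironaka2017.Datum
open Scheme.IdealSheafData

universe u

variable {n : ℕ} {p : ℕ} [Fact p.Prime] {K : Type u} [Field K] [CharP K p]
variable {N : Notions.{u} n} {A A' : AmbientDatum p K} {E : IdealExponent A.Z} {R : Resume N A E}

/-! ## (ii) The ∇-centred reading -/

/-- [OURS · L1 W4.6 rung (iii); NOT a statement of the manuscript] **The ∇-CENTRED typed procedure terminates in the Moh
window on curves** (the repaired reading D1 of «hence terminates», Th. 16.13 p.87 l.26–28, typed `TerminatesNabla`): for every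
notion instance `N` and reading `Rd` there is no infinite ∇-centred run all of whose stages lie in `Regime.mohWindowCurve` —
from the stronger literal-rule statement `terminates_mohWindowCurve` by the anchor `terminatesNabla_of_terminates`. [folklore] -/
theorem terminatesNabla_mohWindowCurve (N : Notions.{u} n) (Rd : Reading p K N) :
    TerminatesNabla N Rd (Regime.mohWindowCurve (p := p) (K := K)) :=
  terminatesNabla_of_terminates (terminates_mohWindowCurve N Rd)

/-- [OURS · L1 W4.6 rung (iii); NOT a statement of the manuscript] **Exit bound, ∇-centred**: every ∇-centred run of the typed
procedure has a stage `k ≤ #Sing(E₀)` outside `Regime.mohWindowCurve`. [folklore] -/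
theorem RunNabla.exists_exit_le_ncard_of_mohWindowCurve {Rd : Reading p K N} (r : RunNabla N Rd) :
    ∃ k ≤ (r.E 0).sing.ncard, ¬ Regime.mohWindowCurve (p := p) (K := K) (r.A k) (r.E k) :=
  r.toRun.exists_exit_le_ncard_of_mohWindowCurve

/-! ## (i) The finiteness slice of `MohWindowCurveStepDrop` -/

/-- [OURS · L1 W4.6 rung (iii); NOT a statement of the manuscript] **In the window the transform again has finitely many
singular points**: for a state `(A, E, R)` in `Regime.mohWindowCurve` and a step `s` admitted by the typed centre rule,
`Sing(E′)` is finite — it injects (by `π`) into the finite set `Sing(E) ∖ {ξ}`, `ξ` the blown-up point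
(`MohWindow.idealOrder_controlledTransform_lt`: nothing singular over `ξ`; orders unchanged and `π` injective off `ξ`). [folklore] -/
theorem Step.sing_finite_of_mohWindowCurve (s : Step R A') (hRg : Regime.mohWindowCurve A E) : s.E'.sing.Finite := by
  classical
  obtain ⟨ξ, hξS, hξcl, hDξ⟩ := s.centre.exists_eq_singleton_of_mohWindowCurve hRg
  obtain ⟨hfin, -, hwin⟩ := hRg
  haveI : IsLocallyNoetherian A'.Z := by
    haveI := A'.smooth
    exact LocallyOfFiniteType.isLocallyNoetherian A'.hom
  have hπ : IsBlowup s.π (vanishingIdeal s.D) := s.blowup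
  -- the singular points of `E′` lie over `Sing(E) ∖ {ξ}` (as in `Step.sing_ncard_lt_of_mohWindowCurve`)
  have hmaps : Set.MapsTo s.π.base s.E'.sing (E.sing \ {ξ}) := by
    intro x' hx'
    have hx'b : (E.b : ℕ∞) ≤ idealOrder (controlledTransform s.π (vanishingIdeal s.D) E.J E.b) x' := hx'
    have hne : s.π.base x' ≠ ξ := by
      intro heq
      have hY : stalkIdeal (vanishingIdeal s.D) (s.π.base x') =
          maximalIdeal (A.Z.presheaf.stalk (s.π.base x')) := by
        apply stalkIdeal_vanishingIdeal_eq_maximalIdeal_of_closure_eq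
        rw [hDξ, heq, hξcl.closure_eq]
      have hW : MohWindowAt E.b (A.Z.presheaf.stalk (s.π.base x')) (stalkIdeal E.J (s.π.base x')) :=
        hwin _ (heq ▸ hξS)
      exact (not_le.mpr (MohWindow.idealOrder_controlledTransform_lt hπ hY hW)) hx'b
    have hnot : s.π.base x' ∉ (vanishingIdeal s.D).support := by
      rw [← SetLike.mem_coe, coe_support_vanishingIdeal, hDξ]
      exact hne
    refine ⟨?_, hne⟩
    show (E.b : ℕ∞) ≤ idealOrder E.J (s.π.base x')
    rw [← hπ.idealOrder_controlledTransform_eq_of_not_mem_support E.J E.b hnot]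
    exact hx'b
  have hinj : Set.InjOn s.π.base s.E'.sing := by
    refine (MohWindow.injOn_preimage_compl hπ).mono fun x' hx' => ?_
    show s.π.base x' ∈ (s.D : Set A.Z)ᶜ
    rw [hDξ]
    exact (hmaps hx').2
  exact Set.Finite.of_finite_image ((hfin.subset fun _ hx => hx.1).subset hmaps.image_subset) hinj

/-- [OURS · L1 W4.6 rung (iii); NOT a statement of the manuscript] `MohWindowCurveStepDrop` with its finiteness conjunct:
in the regime, `Sing(E′)` is finite AND `#Sing(E′) < #Sing(E)`. [folklore] -/
theorem Step.sing_finite_and_ncard_lt_of_mohWindowCurve (s : Step R A') (hRg : Regime.mohWindowCurve A E) :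
    s.E'.sing.Finite ∧ s.E'.sing.ncard < E.sing.ncard :=
  ⟨s.sing_finite_of_mohWindowCurve hRg, s.sing_ncard_lt_of_mohWindowCurve hRg⟩

end CampaignW46

end Summit.ResolutionOfSingularities.ResolutionOfSingularities.Theorems

end
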